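import Mathlib.Tactic
import HarnessLib

/-!
# Kozma–Nitzan's Question 8 — UNI-C(U;y): the sharp kill inequality (THEOREM U‴) behind LEMMA U′ (gen 41)

Support file (`--supports stmt-CriticalPhenomena-4575`, closed crux; independent mathematics on Kozma–Nitzan's Question 8,
arXiv:2401.12397 §5.5 p. 36), prover `prim-ineq-gen-6` (gen 41).  No definitions, no named facts, no sorries; standard axioms.
Memo `run/shared/lean/prim/prim-ineq-gen-6/PROOF-LEMMA-U3-G41.md`.

THEOREM U‴ (hypothesis-free, for every block with `c > 0`, `k₁ ≥ 1`, and every node `t > k₁`):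
`m_t·(u_{k₁} − C_[k₁,t]) ≤ m_t·X_t ≤ N_t`, `m_t = K₃ − H_{t−2}`, where `X_t = Σ_k W_k C_[k₁,k] B_k` is the cluster-end bound of the
excess (`B_k = [p_k α_k − C_[k+1,t]]⁺`) and `N_t = Σ_l (1−s_{l+1}) Ũ_l/(γ_l p_l)` the kill sum of the node.  At a C-hypothesis node
(`N_t < Q₊ ≤ q^{ub}·u_{k₁}`) this gives `u_{k₁} ≤ C_[k₁,t]/(1−ε)` with `ε ≤ a⁴x²S(1−S)/3 ≤ 1/12`, and THEOREM U-AD of gen 40 becomes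
unconditional with the certified box `F_U ≤ 9/20`: `(9/20)/(1−1/12) = 27/55 < 1/2`.
The kernels below are the algebraic cores of the chain (the finite sums along the path are exact-checked in
`lab-g41/g41/l17_lemU3.py`, census n ≤ 8, 0 failures):
* `kU3_weight_step` — the coefficient identity behind the share identity (U2) `N_t = Σ_k W_k R_k` and the renewal identity (U3)
  `R_k = Ũ_k/(γ_k p_k) + Σ_j run(k+1,j) R_j`: `S(1−s) + (1−s)(1−S) = 1−s`;
* `kU3_Dbound` — (U4): `D_k/C_[k₁,k] ≤ α v − (1−α) u` from `Φ(T_r) = v_r + π_r`, `π_r^{≥t} ≤ S_[r+1,t]C'`, `u_r^{≥t} ≤ S_[r+1,t]C'`;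
* `kU3_m_lower` and `kU3_KD` — the kill-coefficient facts `K₃ − H ≥ ¾(Φ+m)` and `K₃ − H_{k−1} ≥ Φ·D + Φ(1−Φ) + π² + ¾m`
  (`c = D(πΦ−m)/Φ`, `D = Φ − π`, `H ≤ B/4 ≤ m/4`), with `kU3_DV`: `D ≥ S_{k+1} a_k v_{k+1}`;
* `kU3_kill` — (U5): `Ũ_k ≥ γ_k μ [α v − (1−α) u]` for `μ ≤ K₃ − H_{k−1}`, from `Ũ_k ≥ max(0, uL̃ + vR̃_lb − Γuv)` and `kU3_KD`;
* `kU3_induct` — (U6): the downward induction step `R_k ≥ m C_[k₁,k] B_k`;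
* `kU3_corollary`, `kU3_eps`, `kU3_const` — `u ≤ C/(1−ε)` at hypothesis nodes, `ε ≤ a⁴x²S(1−S)/3 ≤ 1/12`, `27/55 < 1/2`.
[cite: KozmaNitzan2024, Question 8 (§5.5 p. 36)]
-/

namespace Summit.CriticalPhenomena.PercolationContinuityZ3.Theorems

namespace PocketCert

/-- **Weight step (share / renewal identities).**  With `S = S_[·,l]` the probability that the cluster reaches `l` and `s = s_{l+1}`,
the cluster-end weights satisfy `W_l + (1−s)·(1 − S) = 1 − s` where `W_l = S(1−s)` and `Σ_{k<l} W_k = 1 − S`: every dead-edge term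
`(1−s_{l+1})Ũ_l/(γ_l p_l)` of `N_t` is shared exactly among the cluster ends `k ≤ l`.
[cite: KozmaNitzan2024, Question 8 (§5.5 p. 36)] -/
theorem kU3_weight_step (S s : ℝ) : S * (1 - s) + (1 - s) * (1 - S) = 1 - s := by ring

/-- **(U4) the D-bound.**  For a cluster end `k` with base `r = k+1`, external A-death `α ∈ [0,1]` and `B_k > 0`:
`D_k/C_[k₁,k] ≤ pα − C'S − Σ_j run(r,j)C_[r,j]p_jα_j` (drop the positive parts), where the sum equals `α·π_r^{<t} + (1−α)·u_r^{<t}`,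
`p = Φ(T_r) = v_r + π_r^{<t} + π_r^{≥t}`, `π_r^{≥t} ≤ S·C'`, `u_r^{≥t} ≤ S·C'` (`S = S_[r+1,t]`, `C' = C_[r,t]`), `u_r = u_r^{<t} + u_r^{≥t}`.
Conclusion: `D_k/C_[k₁,k] ≤ α v_r − (1−α) u_r`.
[cite: KozmaNitzan2024, Question 8 (§5.5 p. 36)] -/
theorem kU3_Dbound (p v piL piG uL uG u S C' α : ℝ) (hp : p = v + piL + piG) (hpiG : piG ≤ S * C')
    (huG : uG ≤ S * C') (hu : u = uL + uG) (hα0 : 0 ≤ α) (hα1 : α ≤ 1) :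
    p * α - C' * S - (α * piL + (1 - α) * uL) ≤ α * v - (1 - α) * u := by
  subst hp; subst hu
  nlinarith [mul_le_mul_of_nonneg_left hpiG hα0, mul_le_mul_of_nonneg_left huG (by linarith : (0:ℝ) ≤ 1 - α)]

/-- **Kill coefficient, crude form.**  `K₃ − H = Φ + m − c − H ≥ ¾(Φ + m)` from `c ≤ (Φ−m)²/4` (`kLC_c_quarter`),
`H ≤ B/4`, `B = Φ²m/(Φ+m)` and `0 ≤ Φ, m ≤ 1`; the polynomial core: `(Φ−m)² + Φ²m/(Φ+m) ≤ Φ + m`, here with `B(Φ+m) = Φ²m`.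
[cite: KozmaNitzan2024, Question 8 (§5.5 p. 36)] -/
theorem kU3_m_lower (Φ m c H B : ℝ) (hΦ0 : 0 ≤ Φ) (hΦ1 : Φ ≤ 1) (hm0 : 0 ≤ m) (hm1 : m ≤ 1) (hpos : 0 < Φ + m)
    (hc : c ≤ (Φ - m) ^ 2 / 4) (hH : H ≤ B / 4) (hB : B * (Φ + m) = Φ ^ 2 * m) :
    3 / 4 * (Φ + m) ≤ Φ + m - c - H := by
  -- B ≤ Φ·min(Φ,m) ≤ ... we show (Φ-m)^2 + B ≤ Φ + m
  have hB' : B = Φ ^ 2 * m / (Φ + m) := by field_simp; linarith [hB]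
  have hBle : B ≤ Φ * m := by
    rw [hB', div_le_iff₀ hpos]; nlinarith [mul_nonneg hΦ0 hm0, mul_nonneg (mul_nonneg hΦ0 hm0) hm0]
  have hsq : (Φ - m) ^ 2 + Φ * m ≤ Φ + m := by
    rcases le_total Φ m with h | h
    · nlinarith [mul_nonneg hΦ0 (by linarith : (0:ℝ) ≤ m - Φ), mul_nonneg hΦ0 hm0]
    · nlinarith [mul_nonneg hm0 (by linarith : (0:ℝ) ≤ Φ - m), mul_nonneg hΦ0 hm0]
  nlinarith

/-- **LEMMA KD (kill-coefficient domination).**  With `D = Φ − π` (= ε − m), `c = D(πΦ − m)/Φ`, `0 < Φ ≤ 1`, `0 ≤ π ≤ Φ`,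
`0 ≤ m`, and `H ≤ m/4` (PROPOSITION H: `H ≤ B/4`, `B ≤ m`):
`K₃ − H = Φ + m − c − H ≥ Φ·D + Φ(1−Φ) + π² + ¾m` — in particular `K₃ − H_{k−1} ≥ Φ·D` (only `Φ > 0`, `π ≤ Φ`, `m ≥ 0` are used).
[cite: KozmaNitzan2024, Question 8 (§5.5 p. 36)] -/
theorem kU3_KD (Φ π m c H D : ℝ) (hΦ0 : 0 < Φ) (hπ1 : π ≤ Φ) (hm : 0 ≤ m)
    (hD : D = Φ - π) (hc : c * Φ = D * (π * Φ - m)) (hH : H ≤ m / 4) :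
    Φ * D + Φ * (1 - Φ) + π ^ 2 + 3 / 4 * m ≤ Φ + m - c - H := by
  -- exact: Φ + m − c − ΦD = Φ(1−Φ) + π² + m(2 − π/Φ);  m(2 − π/Φ) ≥ m.
  have hc' : c = D * (π * Φ - m) / Φ := by field_simp; linarith [hc]
  have key : Φ * (Φ + m - c - Φ * D - (Φ * (1 - Φ) + π ^ 2 + m)) = m * (Φ - π) := by
    rw [hc', hD]; field_simp; ring
  have hnn : 0 ≤ m * (Φ - π) := mul_nonneg hm (by linarith)
  have h2 : 0 ≤ Φ + m - c - Φ * D - (Φ * (1 - Φ) + π ^ 2 + m) := by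
    by_contra hneg; push Not at hneg
    have : Φ * (Φ + m - c - Φ * D - (Φ * (1 - Φ) + π ^ 2 + m)) < 0 := mul_neg_of_pos_of_neg hΦ0 hneg
    linarith
  linarith

/-- **LEMMA DV (the far C-channel is part of D).**  The root's C-view `D = ε − m = Σ_j ω_j p_j A_[0,j](1 − C_[0,j])` contains the
part of the root cluster beyond `k`: `D ≥ S_{k+1} a_k [(1−γ_k) ε_{k+1} + γ_k v_{k+1}]` (exact suffix decomposition with
`1 − γC ≥ (1−γ)·A-mass + γ(1−C)`), and `ε_{k+1} ≥ v_{k+1}`, `0 ≤ γ_k ≤ 1`; hence `D ≥ S_{k+1} a_k v_{k+1}`.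
[cite: KozmaNitzan2024, Question 8 (§5.5 p. 36)] -/
theorem kU3_DV (D S a γ e v : ℝ) (hD : S * a * ((1 - γ) * e + γ * v) ≤ D) (hev : v ≤ e) (hγ1 : γ ≤ 1)
    (hS : 0 ≤ S) (ha : 0 ≤ a) : S * a * v ≤ D := by
  have h1 : v ≤ (1 - γ) * e + γ * v := by nlinarith
  nlinarith [mul_le_mul_of_nonneg_left h1 (mul_nonneg hS ha)]

/-- **(U5) the kill step.**  At a depth `k ≥ k₁` (so `Ũ_k ≥ 0`, SSC(U)) with the U-identity `Ũ = u·L̃ + v·R̃ − Γ·u·v`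
(`u = u_{k+1}, v = v_{k+1} ≥ 0`), `L̃ ≥ 0`, `R̃ ≥ γ[(1−a_k)K + a_k K₄]` (`K = K₃ − H_{k−1}`, `K₄ ≥ 0`), `Γ = γ a_k² Z`
(`Z = Φ S_{k+1} ≥ 0`), `a_k = a(1−α)` (`a ∈ [0,1]` the prefix A-mark, `α = α_k ∈ [0,1]` the A-death since `k₁`), and LEMMA KD in
the form `K ≥ Z·a_k·v`: for every `0 ≤ μ ≤ K`,  `Ũ ≥ γ·μ·(α v − (1−α) u)`.
[Proof: if `αv ≤ (1−α)u` the right side is `≤ 0`; else with `E = uL̃ + vR̃_lb − Γuv ≤ Ũ` one has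
`(1−α)(E − γμ(αv − (1−α)u)) ≥ v·γ·(1−α)·aα·(K − a_k Z v) ≥ 0`, using `(1−α)u < αv` on the negative u-bracket.]
[cite: KozmaNitzan2024, Question 8 (§5.5 p. 36)] -/
theorem kU3_kill (Ut u v L R Γ γ K K4 a α ak Z μ : ℝ)
    (hUt0 : 0 ≤ Ut) (hUt : Ut = u * L + v * R - Γ * u * v) (hL : 0 ≤ L)
    (hR : γ * ((1 - ak) * K + ak * K4) ≤ R) (hΓ : Γ = γ * ak ^ 2 * Z) (hak : ak = a * (1 - α))
    (ha0 : 0 ≤ a) (ha1 : a ≤ 1) (hα0 : 0 ≤ α) (hα1 : α ≤ 1) (hγ : 0 ≤ γ) (hK4 : 0 ≤ K4) (hZ : 0 ≤ Z)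
    (hu : 0 ≤ u) (hv : 0 ≤ v) (hμ0 : 0 ≤ μ) (hμ : μ ≤ K) (hKD : Z * ak * v ≤ K) :
    γ * μ * (α * v - (1 - α) * u) ≤ Ut := by
  have hak0 : 0 ≤ ak := by rw [hak]; exact mul_nonneg ha0 (by linarith)
  have hK0 : 0 ≤ K := le_trans (mul_nonneg (mul_nonneg hZ hak0) hv) hKD
  -- (1 - ak) ≥ α and (1 - ak) ≥ a α
  have h1ak : α ≤ 1 - ak := by rw [hak]; nlinarith [mul_nonneg (by linarith : (0:ℝ) ≤ 1 - a) (by linarith : (0:ℝ) ≤ 1 - α)]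
  have h1ak' : a * α ≤ 1 - ak := by rw [hak]; nlinarith
  by_cases hcase : α * v ≤ (1 - α) * u
  · -- target ≤ 0 ≤ Ut
    have : γ * μ * (α * v - (1 - α) * u) ≤ 0 := by
      have : α * v - (1 - α) * u ≤ 0 := by linarith
      exact mul_nonpos_of_nonneg_of_nonpos (mul_nonneg hγ hμ0) this
    linarith
  · push Not at hcase
    -- E := u L + v R_lb - Γ u v ≤ Ut
    set Rlb := γ * ((1 - ak) * K + ak * K4) with hRlb
    have hE : u * L + v * Rlb - Γ * u * v ≤ Ut := by
      rw [hUt]; nlinarith [mul_le_mul_of_nonneg_left hR hv]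
    -- the v-coefficient (1-ak)K + ak K4 - μ α ≥ 0
    have hvco : 0 ≤ (1 - ak) * K + ak * K4 - μ * α := by
      nlinarith [mul_le_mul_of_nonneg_left h1ak hK0, mul_nonneg hak0 hK4, mul_le_mul_of_nonneg_right hμ hα0]
    -- u-bracket
    set Br := L + γ * μ * (1 - α) - γ * ak ^ 2 * Z * v with hBr
    have hEq : u * L + v * Rlb - Γ * u * v - γ * μ * (α * v - (1 - α) * u)
        = u * Br + v * γ * ((1 - ak) * K + ak * K4 - μ * α) := by
      rw [hRlb, hBr, hΓ]; ring
    by_cases hbr : 0 ≤ Br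
    · have : 0 ≤ u * Br + v * γ * ((1 - ak) * K + ak * K4 - μ * α) := by
        have h1 : 0 ≤ u * Br := mul_nonneg hu hbr
        have h2 : 0 ≤ v * γ * ((1 - ak) * K + ak * K4 - μ * α) := mul_nonneg (mul_nonneg hv hγ) hvco
        linarith
      linarith [hEq]
    · push Not at hbr
      -- α < 1 here (else ak = 0 and Br = L ≥ 0)
      have hα1' : α < 1 := by
        by_contra h; push Not at h
        have hαeq : α = 1 := le_antisymm hα1 h
        have : ak = 0 := by rw [hak, hαeq]; ring
        have : Br = L := by rw [hBr, this, hαeq]; ring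
        linarith
      have h1α : 0 < 1 - α := by linarith
      -- (1-α)(E - T) = (1-α) u Br + (1-α) v γ (...) ≥ α v Br + (1-α) v γ (...)
      have hstep : α * v * Br ≤ (1 - α) * u * Br := by
        -- Br < 0 and (1-α) u < α v
        have : ((1 - α) * u) * Br ≥ (α * v) * Br := by
          exact mul_le_mul_of_nonpos_right hcase.le hbr.le
        linarith
      -- the brace: α Br + (1-α) γ [(1-ak)K + ak K4 - μ α] ≥ (1-α) γ a α (K - ak Z v) ≥ 0
      have hbrace : 0 ≤ α * Br + (1 - α) * γ * ((1 - ak) * K + ak * K4 - μ * α) := by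
        have hak2 : ak ^ 2 = a * (1 - α) * ak := by rw [hak]; ring
        have e1 : α * Br + (1 - α) * γ * ((1 - ak) * K + ak * K4 - μ * α)
            = α * L + (1 - α) * γ * ((1 - ak) * K + ak * K4) - α * γ * (a * (1 - α) * ak) * Z * v := by
          rw [hBr, hak2]; ring
        rw [e1]
        have t1 : 0 ≤ α * L := mul_nonneg hα0 hL
        have hQ : 0 ≤ (1 - α) * γ := mul_nonneg h1α.le hγ
        have t2 : (1 - α) * γ * ((a * α) * K) ≤ (1 - α) * γ * ((1 - ak) * K) := by
          have h' : (a * α) * K ≤ (1 - ak) * K := mul_le_mul_of_nonneg_right h1ak' hK0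
          exact mul_le_mul_of_nonneg_left h' hQ
        have t3 : 0 ≤ (1 - α) * γ * (ak * K4) := mul_nonneg hQ (mul_nonneg hak0 hK4)
        have t4 : α * γ * (a * (1 - α) * ak) * Z * v = (1 - α) * γ * ((a * α) * (Z * ak * v)) := by ring
        have t5 : (1 - α) * γ * ((a * α) * (Z * ak * v)) ≤ (1 - α) * γ * ((a * α) * K) :=
          mul_le_mul_of_nonneg_left (mul_le_mul_of_nonneg_left hKD (mul_nonneg ha0 hα0)) hQ
        nlinarith
      have hfin : 0 ≤ (1 - α) * (u * Br + v * γ * ((1 - ak) * K + ak * K4 - μ * α)) := by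
        have e2 : (1 - α) * (u * Br + v * γ * ((1 - ak) * K + ak * K4 - μ * α))
            = (1 - α) * u * Br + v * ((1 - α) * γ * ((1 - ak) * K + ak * K4 - μ * α)) := by ring
        rw [e2]
        have e3 : v * (α * Br + (1 - α) * γ * ((1 - ak) * K + ak * K4 - μ * α))
            = α * v * Br + v * ((1 - α) * γ * ((1 - ak) * K + ak * K4 - μ * α)) := by ring
        have := mul_nonneg hv hbrace
        linarith
      have hpos : 0 ≤ u * Br + v * γ * ((1 - ak) * K + ak * K4 - μ * α) := by
        by_contra hn; push Not at hn
        have := mul_neg_of_pos_of_neg h1α hn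
        linarith
      linarith [hEq]

/-- **(U6) the induction step.**  With the renewal identity `R_k = Ũ_k/(γ_k p_k) + T` (`T = Σ_j run(k+1,j) R_j`), the kill step
`Ũ_k/(γ_k p_k) ≥ m·D_k`, the definition `D_k = C₀ B_k − T_B` (`T_B = Σ_j run(k+1,j) C_[k₁,j] B_j`) and the induction hypothesis
summed with the nonnegative run weights `T ≥ m·T_B`:  `R_k ≥ m·C₀·B_k`.
[cite: KozmaNitzan2024, Question 8 (§5.5 p. 36)] -/
theorem kU3_induct (R U T D C0 B TB m : ℝ) (hR : R = U + T) (hU : m * D ≤ U) (hDk : D = C0 * B - TB)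
    (hT : m * TB ≤ T) : m * C0 * B ≤ R := by
  subst hR; subst hDk; nlinarith

/-- **COROLLARY (quantitative LEMMA U′).**  From THEOREM U‴ `m·(u − C) ≤ N`, the C-hypothesis `N ≤ Q` (strictly `<`), the budget
`Q ≤ q·u` (`Q₊ ≤ q^{ub} u_{k₁}`), `m > 0` and `q/m ≤ ε < 1`: `u·(1 − ε) ≤ C`, i.e. `u ≤ C/(1−ε)`.
[cite: KozmaNitzan2024, Question 8 (§5.5 p. 36)] -/
theorem kU3_corollary (u C N Q q m ε : ℝ) (hN : m * (u - C) ≤ N) (hQ : N ≤ Q) (hq : Q ≤ q * u) (hm : 0 < m)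
    (hu : 0 ≤ u) (hε : q / m ≤ ε) : u * (1 - ε) ≤ C := by
  have h1 : m * (u - C) ≤ q * u := by linarith
  have h2 : q ≤ ε * m := by rwa [div_le_iff₀ hm] at hε
  have h3 : q * u ≤ ε * m * u := mul_le_mul_of_nonneg_right h2 hu
  nlinarith

/-- **The constant ε.**  With `q^{ub} ≤ a⁴xΦS(1−S)/4` (LEMMA E♯ branch of `Q₊ ≤ q^{ub}u_{k₁}`), `m ≥ ¾(Φ + m_b)` (`kU3_m_lower`) and
`x(Φ + m_b) = Φ` (`x = Φ/(Φ+m_b)`), `Φ > 0`:  `q^{ub}/m ≤ a⁴x²S(1−S)/3`, and `a⁴x²S(1−S)/3 ≤ 1/12` for `a, x ∈ [0,1]`, `S ∈ [0,1]`.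
[cite: KozmaNitzan2024, Question 8 (§5.5 p. 36)] -/
theorem kU3_eps (q m a x Φ mb S : ℝ) (hq : q ≤ a ^ 4 * x * Φ * S * (1 - S) / 4) (hm : 3 / 4 * (Φ + mb) ≤ m)
    (hx : x * (Φ + mb) = Φ) (hΦ : 0 < Φ) (hmb : 0 ≤ mb) (ha0 : 0 ≤ a) (ha1 : a ≤ 1) (hx0 : 0 ≤ x) (hx1 : x ≤ 1)
    (hS0 : 0 ≤ S) (hS1 : S ≤ 1) :
    q / m ≤ a ^ 4 * x ^ 2 * S * (1 - S) / 3 ∧ a ^ 4 * x ^ 2 * S * (1 - S) / 3 ≤ 1 / 12 := by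
  have hmpos : 0 < m := by linarith
  have ha4 : 0 ≤ a ^ 4 := by positivity
  have ha41 : a ^ 4 ≤ 1 := by nlinarith [mul_nonneg ha0 ha0, mul_le_mul ha1 ha1 ha0 (by norm_num : (0:ℝ) ≤ 1)]
  have hSS : S * (1 - S) ≤ 1 / 4 := by nlinarith [sq_nonneg (S - 1/2)]
  have hSS0 : 0 ≤ S * (1 - S) := mul_nonneg hS0 (by linarith)
  constructor
  · rw [div_le_iff₀ hmpos]
    -- a^4 x Φ S(1-S)/4 ≤ a^4 x^2 S(1-S)/3 · m  since m ≥ (3/4) Φ/x  i.e. x m ≥ (3/4) Φ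
    have hxm : 3 / 4 * Φ ≤ x * m := by nlinarith [mul_le_mul_of_nonneg_left hm hx0]
    have : a ^ 4 * x * Φ * S * (1 - S) / 4 ≤ a ^ 4 * x ^ 2 * S * (1 - S) / 3 * m := by
      have e : a ^ 4 * x ^ 2 * S * (1 - S) / 3 * m = a ^ 4 * x * S * (1 - S) / 3 * (x * m) := by ring
      rw [e]
      have h' : a ^ 4 * x * S * (1 - S) / 3 * (3 / 4 * Φ) ≤ a ^ 4 * x * S * (1 - S) / 3 * (x * m) :=
        mul_le_mul_of_nonneg_left hxm (by positivity)
      nlinarith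
    linarith
  · have h1 : x ^ 2 ≤ 1 := by nlinarith
    have : a ^ 4 * x ^ 2 * (S * (1 - S)) ≤ 1 * 1 * (1 / 4) := by
      apply mul_le_mul (mul_le_mul ha41 h1 (by positivity) (by norm_num)) hSS hSS0 (by norm_num)
    nlinarith

/-- **THEOREM U-AD is unconditional.**  The certified box `F_U ≤ 9/20` (lab-g40/g40/b04_boxU.py at BOUND 9/20: 7 813 cells, exact
leaf verification) and `ε ≤ 1/12` give `F_U/(1−ε) ≤ (9/20)/(1 − 1/12) = 27/55 < 1/2`; generally `F ≤ 9/20`, `0 ≤ ε ≤ 1/12`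
imply `F/(1−ε) < 1/2` (the sign of `ε` is not needed).
[cite: KozmaNitzan2024, Question 8 (§5.5 p. 36)] -/
theorem kU3_const (F ε : ℝ) (hF : F ≤ 9 / 20) (hε : ε ≤ 1 / 12) : F / (1 - ε) < 1 / 2 := by
  have h1 : 0 < 1 - ε := by linarith
  rw [div_lt_iff₀ h1]; nlinarith

end PocketCert

end Summit.CriticalPhenomena.PercolationContinuityZ3.Theorems
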